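import Literature.MathematicalPhysics.KineticTheory.LangevinChainSDE
import Literature.MathematicalPhysics.KineticTheory.LangevinChainGibbs

/-!
# `ℓ¹` Lipschitz algebra of the pinned chain: forces and currents under a configuration change

Support file for item `stmt-AtomisticToContinuum-9139` (`OddSectorIrreversibility.OddCorrectorDecay`), negative
side: the deterministic algebra behind the bath-locality estimate (open vs. closed chain started at the same
phase point). For the pinned chain `pinnedChain ω₂ lam β γ` (`U'(q) = ω₂q + lam q³`, `V'(r) = r + βr³`) and two
configurations whose squared coordinates / bond stretches are bounded by `Mq`, `Mr`:
* `abs_deriv_U_sub_le`, `abs_deriv_V_sub_le` — `|U'(a) - U'(b)| ≤ (ω₂ + 3 lam Mq)|a - b|`,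
  `|V'(r) - V'(s)| ≤ (1 + 3βMr)|r - s|` (cubic algebra, no mean value theorem);
* `sum_abs_dPotential_sub_le` — the `N`-FREE `ℓ¹` bound on the force difference
  `∑_i |∂_iΦ(q) - ∂_iΦ(q')| ≤ (ω₂ + 3 lam Mq + 4(1 + 3βMr)) ∑_i |q_i - q'_i|`;
* `abs_totalCurrent_sub_le` — `|J(x) - J(x')| ≤ W · (∑_i |q_i - q'_i| + ∑_i |p_i - p'_i|)` with an explicit
  weight `W` polynomial in the coordinate bounds (`J = ∑_i j_i`, `j_i = -(p_i + p_{i+1}) V'(r_i)/2`).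
The column sums of the tridiagonal Hessian are what make the constants `N`-free.
-/

noncomputable section

open Finset
open Literature.MathematicalPhysics.KineticTheory.HeatConduction

namespace Summit.AtomisticToContinuum.FouriersLaw.Theorems.ChainVariation

variable {N : ℕ}

/-! ### One-variable cubic algebra -/

/-- `|(a + c a³) - (b + c b³)|`-type bound: `|ω(a-b) + c(a³-b³)| ≤ (ω + 3cM)|a-b|` when `a², b² ≤ M`,
`ω, c ≥ 0`. [folklore] -/
theorem abs_cubic_sub_le {ω c M a b : ℝ} (hω : 0 ≤ ω) (hc : 0 ≤ c) (ha : a ^ 2 ≤ M) (hb : b ^ 2 ≤ M) :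
    |(ω * a + c * a ^ 3) - (ω * b + c * b ^ 3)| ≤ (ω + 3 * c * M) * |a - b| := by
  have hM : 0 ≤ M := (sq_nonneg a).trans ha
  have hab : |a * b| ≤ M := by
    rw [abs_mul]
    have h1 : |a| ^ 2 ≤ M := by rwa [sq_abs]
    have h2 : |b| ^ 2 ≤ M := by rwa [sq_abs]
    nlinarith [abs_nonneg a, abs_nonneg b]
  have hfac : (ω * a + c * a ^ 3) - (ω * b + c * b ^ 3) = (a - b) * (ω + c * (a ^ 2 + a * b + b ^ 2)) := by ring
  rw [hfac, abs_mul, mul_comm]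
  refine mul_le_mul_of_nonneg_right ?_ (abs_nonneg _)
  have h3 : |ω + c * (a ^ 2 + a * b + b ^ 2)| ≤ ω + c * (a ^ 2 + |a * b| + b ^ 2) := by
    rw [abs_le]
    constructor
    · nlinarith [neg_abs_le (a * b), mul_nonneg hc (sq_nonneg a), mul_nonneg hc (sq_nonneg b),
        mul_nonneg hc (abs_nonneg (a*b))]
    · nlinarith [le_abs_self (a * b)]
  calc |ω + c * (a ^ 2 + a * b + b ^ 2)| ≤ ω + c * (a ^ 2 + |a * b| + b ^ 2) := h3
    _ ≤ ω + 3 * c * M := by nlinarith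

/-- `|U'(a) - U'(b)| ≤ (ω₂ + 3 lam Mq)|a - b|` for the pinned chain when `a², b² ≤ Mq` (`ω₂, lam ≥ 0`).
[folklore] -/
theorem abs_deriv_U_sub_le {ω₂ lam : ℝ} (hω : 0 ≤ ω₂) (hl : 0 ≤ lam) (β γ : ℝ) {Mq a b : ℝ}
    (ha : a ^ 2 ≤ Mq) (hb : b ^ 2 ≤ Mq) :
    |deriv (pinnedChain ω₂ lam β γ).U a - deriv (pinnedChain ω₂ lam β γ).U b| ≤
      (ω₂ + 3 * lam * Mq) * |a - b| := by
  rw [pinnedChain_deriv_U, pinnedChain_deriv_U]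
  exact abs_cubic_sub_le hω hl ha hb

/-- `|V'(r) - V'(s)| ≤ (1 + 3βMr)|r - s|` for the pinned chain when `r², s² ≤ Mr` (`β ≥ 0`). [folklore] -/
theorem abs_deriv_V_sub_le {β : ℝ} (hβ : 0 ≤ β) (ω₂ lam γ : ℝ) {Mr r s : ℝ}
    (hr : r ^ 2 ≤ Mr) (hs : s ^ 2 ≤ Mr) :
    |deriv (pinnedChain ω₂ lam β γ).V r - deriv (pinnedChain ω₂ lam β γ).V s| ≤
      (1 + 3 * β * Mr) * |r - s| := by
  rw [pinnedChain_deriv_V, pinnedChain_deriv_V]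
  have := abs_cubic_sub_le (ω := 1) (c := β) zero_le_one hβ hr hs
  simpa using this

/-! ### Nearest-neighbour bookkeeping -/

/-- At most one `k` precedes a given `l`: `∑_k [l = k+1] ≤ 1`. [folklore] -/
theorem sum_ite_succ_left_le_one (l : Fin N) :
    ∑ k : Fin N, (if l.val = k.val + 1 then (1:ℝ) else 0) ≤ 1 := by
  rw [Finset.sum_boole]
  have : ((univ.filter fun k : Fin N => l.val = k.val + 1).card : ℝ) ≤ 1 := by
    exact_mod_cast Finset.card_le_one.2 fun a ha b hb => by
      rw [Finset.mem_filter] at ha hb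
      exact Fin.ext (by omega)
  simpa using this

/-- At most one `l` follows a given `k`: `∑_l [l = k+1] ≤ 1`. [folklore] -/
theorem sum_ite_succ_right_le_one (k : Fin N) :
    ∑ l : Fin N, (if l.val = k.val + 1 then (1:ℝ) else 0) ≤ 1 := by
  rw [Finset.sum_boole]
  have : ((univ.filter fun l : Fin N => l.val = k.val + 1).card : ℝ) ≤ 1 := by
    exact_mod_cast Finset.card_le_one.2 fun a ha b hb => by
      rw [Finset.mem_filter] at ha hb
      exact Fin.ext (by omega)
  simpa using this

/-- `∑_k ∑_l [l = k+1] (f l + f k) ≤ 2 ∑_i f i` for `f ≥ 0` (each site is the upper end of at most one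
bond and the lower end of at most one bond). [folklore] -/
theorem sum_sum_succ_le (f : Fin N → ℝ) (hf : ∀ i, 0 ≤ f i) :
    ∑ k : Fin N, ∑ l : Fin N, (if l.val = k.val + 1 then f l + f k else 0) ≤ 2 * ∑ i, f i := by
  have h1 : ∑ k : Fin N, ∑ l : Fin N, (if l.val = k.val + 1 then f l else 0) ≤ ∑ i, f i := by
    rw [Finset.sum_comm]
    refine Finset.sum_le_sum fun l _ => ?_
    have : ∑ k : Fin N, (if l.val = k.val + 1 then f l else 0) =
        f l * ∑ k : Fin N, (if l.val = k.val + 1 then (1:ℝ) else 0) := by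
      rw [Finset.mul_sum]
      exact Finset.sum_congr rfl fun k _ => by split_ifs <;> simp
    rw [this]
    calc f l * ∑ k : Fin N, (if l.val = k.val + 1 then (1:ℝ) else 0) ≤ f l * 1 :=
          mul_le_mul_of_nonneg_left (sum_ite_succ_left_le_one l) (hf l)
      _ = f l := mul_one _
  have h2 : ∑ k : Fin N, ∑ l : Fin N, (if l.val = k.val + 1 then f k else 0) ≤ ∑ i, f i := by
    refine Finset.sum_le_sum fun k _ => ?_
    have : ∑ l : Fin N, (if l.val = k.val + 1 then f k else 0) =
        f k * ∑ l : Fin N, (if l.val = k.val + 1 then (1:ℝ) else 0) := by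
      rw [Finset.mul_sum]
      exact Finset.sum_congr rfl fun l _ => by split_ifs <;> simp
    rw [this]
    calc f k * ∑ l : Fin N, (if l.val = k.val + 1 then (1:ℝ) else 0) ≤ f k * 1 :=
          mul_le_mul_of_nonneg_left (sum_ite_succ_right_le_one k) (hf k)
      _ = f k := mul_one _
  have hsplit : ∑ k : Fin N, ∑ l : Fin N, (if l.val = k.val + 1 then f l + f k else 0) =
      (∑ k : Fin N, ∑ l : Fin N, (if l.val = k.val + 1 then f l else 0)) +
        ∑ k : Fin N, ∑ l : Fin N, (if l.val = k.val + 1 then f k else 0) := by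
    rw [← Finset.sum_add_distrib]
    refine Finset.sum_congr rfl fun k _ => ?_
    rw [← Finset.sum_add_distrib]
    refine Finset.sum_congr rfl fun l _ => ?_
    split_ifs <;> simp
  rw [hsplit]
  linarith

/-! ### The `ℓ¹` force bound -/

section Force

variable {ω₂ lam β : ℝ} (hω : 0 ≤ ω₂) (hl : 0 ≤ lam) (hβ : 0 ≤ β) (γ : ℝ)
include hω hl hβ

/-- **`N`-free `ℓ¹` Lipschitz bound on the forces.** If `q_i², q'_i² ≤ Mq` for all `i` and
`(q_l - q_k)², (q'_l - q'_k)² ≤ Mr` for all bonds `l = k+1`, then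
`∑_i |∂_iΦ(q) - ∂_iΦ(q')| ≤ (ω₂ + 3 lam Mq + 4(1 + 3βMr)) ∑_i |q_i - q'_i|`. [folklore] -/
theorem sum_abs_dPotential_sub_le {Mq Mr : ℝ} (hMr : 0 ≤ Mr) (q q' : Fin N → ℝ)
    (hq : ∀ i, q i ^ 2 ≤ Mq) (hq' : ∀ i, q' i ^ 2 ≤ Mq)
    (hr : ∀ k l : Fin N, l.val = k.val + 1 → (q l - q k) ^ 2 ≤ Mr)
    (hr' : ∀ k l : Fin N, l.val = k.val + 1 → (q' l - q' k) ^ 2 ≤ Mr) :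
    ∑ i, |(pinnedChain ω₂ lam β γ).dPotential N i q - (pinnedChain ω₂ lam β γ).dPotential N i q'| ≤
      (ω₂ + 3 * lam * Mq + 4 * (1 + 3 * β * Mr)) * ∑ i, |q i - q' i| := by
  set P := pinnedChain ω₂ lam β γ with hP
  set KU : ℝ := ω₂ + 3 * lam * Mq with hKU
  set KV : ℝ := 1 + 3 * β * Mr with hKV
  -- per-site pinning part
  have hUi : ∀ i, |deriv P.U (q i) - deriv P.U (q' i)| ≤ KU * |q i - q' i| := fun i =>
    abs_deriv_U_sub_le hω hl β γ (hq i) (hq' i)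
  -- per-bond interaction part, weighted by the (at most two) incidence signs
  have hkl : ∀ (i k l : Fin N),
      |(if l.val = k.val + 1 then deriv P.V (q l - q k) *
          ((if l = i then 1 else 0) - (if k = i then 1 else 0)) else 0) -
        (if l.val = k.val + 1 then deriv P.V (q' l - q' k) *
          ((if l = i then 1 else 0) - (if k = i then 1 else 0)) else 0)| ≤
      (if l.val = k.val + 1 then KV * (|q l - q' l| + |q k - q' k|) *
          |((if l = i then (1:ℝ) else 0) - (if k = i then 1 else 0))| else 0) := by
    intro i k l
    by_cases hlk : l.val = k.val + 1
    · simp only [if_pos hlk]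
      rw [← sub_mul, abs_mul]
      refine mul_le_mul_of_nonneg_right ?_ (abs_nonneg _)
      calc |deriv P.V (q l - q k) - deriv P.V (q' l - q' k)|
          ≤ KV * |(q l - q k) - (q' l - q' k)| := abs_deriv_V_sub_le hβ ω₂ lam γ (hr k l hlk) (hr' k l hlk)
        _ ≤ KV * (|q l - q' l| + |q k - q' k|) := by
            refine mul_le_mul_of_nonneg_left ?_ (by positivity)
            calc |(q l - q k) - (q' l - q' k)| = |(q l - q' l) - (q k - q' k)| := by ring_nf
              _ ≤ |q l - q' l| + |q k - q' k| := abs_sub _ _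
    · simp only [if_neg hlk, sub_zero, abs_zero, le_refl]
  -- sum over i of the incidence weights is 2
  have hinc : ∀ k l : Fin N, l.val = k.val + 1 →
      ∑ i : Fin N, |((if l = i then (1:ℝ) else 0) - (if k = i then 1 else 0))| ≤ 2 := by
    intro k l hlk
    have hne : l ≠ k := fun h => by subst h; omega
    calc ∑ i : Fin N, |((if l = i then (1:ℝ) else 0) - (if k = i then 1 else 0))|
        ≤ ∑ i : Fin N, ((if l = i then (1:ℝ) else 0) + (if k = i then 1 else 0)) :=
          Finset.sum_le_sum fun i _ => by split_ifs <;> simp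
      _ = 2 := by
          rw [Finset.sum_add_distrib, Finset.sum_ite_eq, Finset.sum_ite_eq]
          simp; norm_num
  -- assemble
  calc ∑ i, |P.dPotential N i q - P.dPotential N i q'|
      ≤ ∑ i, (KU * |q i - q' i| + ∑ k : Fin N, ∑ l : Fin N,
          (if l.val = k.val + 1 then KV * (|q l - q' l| + |q k - q' k|) *
            |((if l = i then (1:ℝ) else 0) - (if k = i then 1 else 0))| else 0)) := by
        refine Finset.sum_le_sum fun i _ => ?_
        unfold OscillatorChain.dPotential
        have e : ∀ a b c d : ℝ, (a + b) - (c + d) = (a - c) + (b - d) := fun a b c d => by ring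
        rw [e]
        refine (abs_add_le _ _).trans (add_le_add (hUi i) ?_)
        rw [← Finset.sum_sub_distrib]
        refine (Finset.abs_sum_le_sum_abs _ _).trans (Finset.sum_le_sum fun k _ => ?_)
        rw [← Finset.sum_sub_distrib]
        exact (Finset.abs_sum_le_sum_abs _ _).trans (Finset.sum_le_sum fun l _ => hkl i k l)
    _ = KU * ∑ i, |q i - q' i| + ∑ k : Fin N, ∑ l : Fin N, ∑ i : Fin N,
          (if l.val = k.val + 1 then KV * (|q l - q' l| + |q k - q' k|) *
            |((if l = i then (1:ℝ) else 0) - (if k = i then 1 else 0))| else 0) := by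
        rw [Finset.sum_add_distrib, Finset.mul_sum]
        congr 1
        rw [Finset.sum_comm]
        refine Finset.sum_congr rfl fun k _ => ?_
        rw [Finset.sum_comm]
    _ ≤ KU * ∑ i, |q i - q' i| + ∑ k : Fin N, ∑ l : Fin N,
          (if l.val = k.val + 1 then 2 * KV * (|q l - q' l| + |q k - q' k|) else 0) := by
        refine add_le_add le_rfl (Finset.sum_le_sum fun k _ => Finset.sum_le_sum fun l _ => ?_)
        by_cases hlk : l.val = k.val + 1
        · simp only [if_pos hlk]
          rw [← Finset.mul_sum]
          have h0 : 0 ≤ KV * (|q l - q' l| + |q k - q' k|) := by positivity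
          calc KV * (|q l - q' l| + |q k - q' k|) *
                ∑ i : Fin N, |((if l = i then (1:ℝ) else 0) - (if k = i then 1 else 0))|
              ≤ KV * (|q l - q' l| + |q k - q' k|) * 2 := mul_le_mul_of_nonneg_left (hinc k l hlk) h0
            _ = 2 * KV * (|q l - q' l| + |q k - q' k|) := by ring
        · simp [if_neg hlk]
    _ = KU * ∑ i, |q i - q' i| + 2 * KV * ∑ k : Fin N, ∑ l : Fin N,
          (if l.val = k.val + 1 then (|q l - q' l| + |q k - q' k|) else 0) := by
        congr 1
        rw [Finset.mul_sum]
        refine Finset.sum_congr rfl fun k _ => ?_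
        rw [Finset.mul_sum]
        refine Finset.sum_congr rfl fun l _ => ?_
        split_ifs <;> ring
    _ ≤ KU * ∑ i, |q i - q' i| + 2 * KV * (2 * ∑ i, |q i - q' i|) := by
        have hKV0 : 0 ≤ KV := by simp only [hKV]; positivity
        exact add_le_add le_rfl (mul_le_mul_of_nonneg_left
          (sum_sum_succ_le (fun i => |q i - q' i|) fun i => abs_nonneg _) (by positivity))
    _ = (ω₂ + 3 * lam * Mq + 4 * (1 + 3 * β * Mr)) * ∑ i, |q i - q' i| := by
        simp only [hKU, hKV]; ring

end Force


/-! ### The current difference -/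

section Current

variable {β : ℝ} (hβ : 0 ≤ β) (ω₂ lam γ : ℝ)
include hβ

/-- **`N`-free bound on the total-current difference.** With `J(x) = ∑_i j_i(x)`,
`j_i = -(p_i + p_{i+1}) V'(q_{i+1} - q_i)/2`: if along the configuration `x` every bond force is bounded,
`|V'(q_{i+1} - q_i)| ≤ BV`, the momenta of `x'` are bounded, `|p'_i| ≤ Bp`, and all bond stretches of
`x, x'` have squares `≤ Mr`, then
`|J(x) - J(x')| ≤ BV ∑_i |p_i - p'_i| + 2 Bp (1 + 3βMr) ∑_i |q_i - q'_i|`. [folklore] -/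
theorem abs_totalCurrent_sub_le {BV Bp Mr : ℝ} (hBV : 0 ≤ BV) (hBp : 0 ≤ Bp) (hMr : 0 ≤ Mr)
    (x x' : PhaseSpace N)
    (hV : ∀ i j : Fin N, j.val = i.val + 1 → |deriv (pinnedChain ω₂ lam β γ).V (x.1 j - x.1 i)| ≤ BV)
    (hp' : ∀ i, |x'.2 i| ≤ Bp)
    (hr : ∀ i j : Fin N, j.val = i.val + 1 → (x.1 j - x.1 i) ^ 2 ≤ Mr)
    (hr' : ∀ i j : Fin N, j.val = i.val + 1 → (x'.1 j - x'.1 i) ^ 2 ≤ Mr) :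
    |(∑ i, (pinnedChain ω₂ lam β γ).bondCurrent N i x) - ∑ i, (pinnedChain ω₂ lam β γ).bondCurrent N i x'| ≤
      BV * ∑ i, |x.2 i - x'.2 i| + 2 * Bp * (1 + 3 * β * Mr) * ∑ i, |x.1 i - x'.1 i| := by
  set P := pinnedChain ω₂ lam β γ with hP
  set KV : ℝ := 1 + 3 * β * Mr with hKV
  have hKV0 : 0 ≤ KV := by simp only [hKV]; positivity
  -- per-bond estimate
  have hij : ∀ i j : Fin N,
      |(if j.val = i.val + 1 then -((x.2 i + x.2 j) / 2 * deriv P.V (x.1 j - x.1 i)) else 0) -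
        (if j.val = i.val + 1 then -((x'.2 i + x'.2 j) / 2 * deriv P.V (x'.1 j - x'.1 i)) else 0)| ≤
      (if j.val = i.val + 1 then
        (BV / 2 * (|x.2 j - x'.2 j| + |x.2 i - x'.2 i|) + Bp * KV * (|x.1 j - x'.1 j| + |x.1 i - x'.1 i|))
        else 0) := by
    intro i j
    by_cases h : j.val = i.val + 1
    · simp only [if_pos h]
      set a := deriv P.V (x.1 j - x.1 i) with ha
      set a' := deriv P.V (x'.1 j - x'.1 i) with ha'
      have hda : |a - a'| ≤ KV * (|x.1 j - x'.1 j| + |x.1 i - x'.1 i|) := by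
        calc |a - a'| ≤ KV * |(x.1 j - x.1 i) - (x'.1 j - x'.1 i)| :=
              abs_deriv_V_sub_le hβ ω₂ lam γ (hr i j h) (hr' i j h)
          _ ≤ KV * (|x.1 j - x'.1 j| + |x.1 i - x'.1 i|) := by
              refine mul_le_mul_of_nonneg_left ?_ hKV0
              calc |(x.1 j - x.1 i) - (x'.1 j - x'.1 i)| = |(x.1 j - x'.1 j) - (x.1 i - x'.1 i)| := by ring_nf
                _ ≤ _ := abs_sub _ _
      have e : -((x.2 i + x.2 j) / 2 * a) - -((x'.2 i + x'.2 j) / 2 * a') =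
          -(((x.2 i - x'.2 i) + (x.2 j - x'.2 j)) / 2 * a) - (x'.2 i + x'.2 j) / 2 * (a - a') := by ring
      rw [e]
      refine (abs_sub _ _).trans ?_
      rw [abs_neg, abs_mul, abs_mul, abs_div, abs_div, abs_two]
      have h1 : |x.2 i - x'.2 i + (x.2 j - x'.2 j)| / 2 * |a| ≤ BV / 2 * (|x.2 j - x'.2 j| + |x.2 i - x'.2 i|) := by
        have := abs_add_le (x.2 i - x'.2 i) (x.2 j - x'.2 j)
        have haBV := hV i j h
        calc |x.2 i - x'.2 i + (x.2 j - x'.2 j)| / 2 * |a|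
            ≤ (|x.2 i - x'.2 i| + |x.2 j - x'.2 j|) / 2 * BV :=
              mul_le_mul (by linarith) haBV (abs_nonneg _) (by positivity)
          _ = BV / 2 * (|x.2 j - x'.2 j| + |x.2 i - x'.2 i|) := by ring
      have h2 : |x'.2 i + x'.2 j| / 2 * |a - a'| ≤ Bp * KV * (|x.1 j - x'.1 j| + |x.1 i - x'.1 i|) := by
        have := abs_add_le (x'.2 i) (x'.2 j)
        have hpi := hp' i
        have hpj := hp' j
        calc |x'.2 i + x'.2 j| / 2 * |a - a'| ≤ Bp * (KV * (|x.1 j - x'.1 j| + |x.1 i - x'.1 i|)) :=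
              mul_le_mul (by linarith) hda (abs_nonneg _) hBp
          _ = Bp * KV * (|x.1 j - x'.1 j| + |x.1 i - x'.1 i|) := by ring
      linarith
    · simp [if_neg h]
  calc |(∑ i, P.bondCurrent N i x) - ∑ i, P.bondCurrent N i x'|
      = |∑ i, ∑ j : Fin N, ((if j.val = i.val + 1 then -((x.2 i + x.2 j) / 2 * deriv P.V (x.1 j - x.1 i)) else 0) -
          (if j.val = i.val + 1 then -((x'.2 i + x'.2 j) / 2 * deriv P.V (x'.1 j - x'.1 i)) else 0))| := by
        unfold OscillatorChain.bondCurrent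
        rw [← Finset.sum_sub_distrib]
        congr 1
        refine Finset.sum_congr rfl fun i _ => ?_
        rw [← Finset.sum_sub_distrib]
    _ ≤ ∑ i, ∑ j : Fin N, (if j.val = i.val + 1 then
          (BV / 2 * (|x.2 j - x'.2 j| + |x.2 i - x'.2 i|) + Bp * KV * (|x.1 j - x'.1 j| + |x.1 i - x'.1 i|))
          else 0) := by
        refine (Finset.abs_sum_le_sum_abs _ _).trans (Finset.sum_le_sum fun i _ => ?_)
        exact (Finset.abs_sum_le_sum_abs _ _).trans (Finset.sum_le_sum fun j _ => hij i j)
    _ = BV / 2 * ∑ i, ∑ j : Fin N, (if j.val = i.val + 1 then |x.2 j - x'.2 j| + |x.2 i - x'.2 i| else 0) +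
        Bp * KV * ∑ i, ∑ j : Fin N, (if j.val = i.val + 1 then |x.1 j - x'.1 j| + |x.1 i - x'.1 i| else 0) := by
        rw [Finset.mul_sum, Finset.mul_sum, ← Finset.sum_add_distrib]
        refine Finset.sum_congr rfl fun i _ => ?_
        rw [Finset.mul_sum, Finset.mul_sum, ← Finset.sum_add_distrib]
        refine Finset.sum_congr rfl fun j _ => ?_
        split_ifs <;> ring
    _ ≤ BV / 2 * (2 * ∑ i, |x.2 i - x'.2 i|) + Bp * KV * (2 * ∑ i, |x.1 i - x'.1 i|) := by
        refine add_le_add (mul_le_mul_of_nonneg_left ?_ (by positivity))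
          (mul_le_mul_of_nonneg_left ?_ (by positivity))
        · exact sum_sum_succ_le (fun i => |x.2 i - x'.2 i|) fun i => abs_nonneg _
        · exact sum_sum_succ_le (fun i => |x.1 i - x'.1 i|) fun i => abs_nonneg _
    _ = BV * ∑ i, |x.2 i - x'.2 i| + 2 * Bp * (1 + 3 * β * Mr) * ∑ i, |x.1 i - x'.1 i| := by
        simp only [hKV]; ring

end Current

end Summit.AtomisticToContinuum.FouriersLaw.Theorems.ChainVariation

end
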